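import Summits.BirchSwinnertonDyer.BirchSwinnertonDyer.Theorems.PrintX9HowardContainmentLightFrameOfPrintOfNonvanishing
import HarnessLib

/-!
# Line `torsion-depth-light` on crux `HowardContainmentLightFrame` (stmt-BirchSwinnertonDyer-24424, the UNTIED light
# Howard containment A_light), RESHAPED CUT v2 — the HONEST TWO-LEAF SKELETON (x9-p2 g9, 2026-08-29; PUBLISHED as a
# crux workfile + evidence, NOT registered: under the interim single-slot rule (director-bsd 2026-08-29T00:34:11Z) the
# registrant is the crux LEAD / the route's tenure planner — «LEAD / pen please register if adopted»)

The planner's cut (plan g7, skeleton f96db6847af9: `stub_coprimeClassNumber`, `stub_depthZero_divisibleClassNumber`,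
`stub_depthPos_localized`, `stub_depthPos_muPart`, split by `p ∣ h_K` and the torsion depth δ) is superseded by the landed
SCALING REDUCTION (x9-p2 v3 → x9-p1 LEAD g5, p681863): on every rank-one light X9 frame, at ANY class number and ANY torsion
depth, A_light follows from exactly TWO cite-only print leaves of the route — CGLS 2022 Thm. 4.1.1 (`CGLSHeegnerClassNonvanishing`,
stmt-27103: torsion-free `𝔖`, `Λκ_∞(C) ≠ ⊥`, torsion quotient; Cornut–Vatsal) and Castella–Grossi–Skinner 2025 Thm. 6.5.2
(`CGSHowardDivisibilityPLocalized`, stmt-27112, the `p`-localized Howard divisibility that REPLACED the CGLS 4.1.3 binder 25234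
in the live `closes`; consumers recover 4.1.3 by `thm413_of_thm652_stabilized`) — the anticyclotomic tower being the THEOREM
`anticyclotomicTowerSharp` (p681245) and the `p^m` being absorbed by the untied `∃ F` (μ-blind rescaling
`PrintX9Rescaling.stub_rescaling`):
`PrintX9OfPrintNonvanishing.howardContainmentLightFrame_of_nonvanishing_of_cgs :
CGLSHeegnerClassNonvanishing → CGSHowardDivisibilityPLocalized → HowardContainmentLightFrame`
(the CGLS-4.1.3 variant `…_of_nonvanishing_of_cgls` with leaf 25234 is in the same file).
None of the four planner stubs is landable by name (each restates a regime whose print input is a cite-only `def : Prop`);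
this cut records instead the two leaves the kernel proof consumes, as stub letters that ARE the leaves by name, so the registry
reads «24424 closes modulo exactly 27103 + 27112». No Howard port, no Mastella–Zerman input, no μ-invariant statement.
Composition `HowardContainmentLightFrame_of` concludes the crux BY NAME; `sorry` only inside `stub_*`.
No summit statement is proved; BSD is NOT proved by any of this.
-/

set_option linter.dupNamespace false
set_option autoImplicit false

namespace Summit.BirchSwinnertonDyer.BirchSwinnertonDyer.Cruxes.HowardContainmentLightFrame.TorsionDepthLight

/-! ## Stub statements as named propositions -/

/-- **Leaf 1: CGLS 2022 Thm. 4.1.1 + Rem. 4.1.4 + §3.3 BY NAME** — the route's cite-only print leaf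
`CGLSHeegnerClassNonvanishing` (stmt-BirchSwinnertonDyer-27103) verbatim.
[cite: CastellaGrossiLeeSkinner2022, Thm. 4.1.1, Rem. 4.1.4 (arXiv:2008.02571 §4.1)] [cite: CornutVatsal2007, Thm. 1.5] -/
def Stmt.stub_cglsHeegnerClassNonvanishing : Prop :=
  Summit.BirchSwinnertonDyer.BirchSwinnertonDyer.Theses.PrintX9.CGLSHeegnerClassNonvanishing

/-- **Leaf 2: Castella–Grossi–Skinner 2025 Thm. 6.5.2 (`p`-LOCALIZED Howard divisibility at any class number and
corank), BY NAME** — the route's cite-only print leaf `CGSHowardDivisibilityPLocalized` (stmt-BirchSwinnertonDyer-27112)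
verbatim (binder `hCGS` of the live `closes`). [cite: CastellaGrossiSkinner2025, Thm. 6.5.2 (arXiv:2303.04373)]
[cite: CastellaGrossiLeeSkinner2022, Thm. 4.1.3, Rem. 4.1.4] -/
def Stmt.stub_cgsHowardDivisibilityPLocalized : Prop :=
  Summit.BirchSwinnertonDyer.BirchSwinnertonDyer.Theses.PrintX9.CGSHowardDivisibilityPLocalized

/-! ## The stubs (the ONLY sorries of the file) -/

/-- Stub: the print leaf `CGLSHeegnerClassNonvanishing` (stmt-BirchSwinnertonDyer-27103), cite-only. -/
theorem stub_cglsHeegnerClassNonvanishing : Stmt.stub_cglsHeegnerClassNonvanishing := by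
  sorry

/-- Stub: the print leaf `CGSHowardDivisibilityPLocalized` (stmt-BirchSwinnertonDyer-27112), cite-only. -/
theorem stub_cgsHowardDivisibilityPLocalized : Stmt.stub_cgsHowardDivisibilityPLocalized := by
  sorry

/-! ## Composition (kernel-checked, no `sorry`) -/

/-- **The crux BY NAME from the two leaves**: the landed theorem
`PrintX9OfPrintNonvanishing.howardContainmentLightFrame_of_nonvanishing_of_cgs` (p681863) applied to the stub letters
(which unfold to the leaves by `rfl`). -/
theorem HowardContainmentLightFrame_of (hNV : Stmt.stub_cglsHeegnerClassNonvanishing)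
    (hCGS : Stmt.stub_cgsHowardDivisibilityPLocalized) :
    Summit.BirchSwinnertonDyer.BirchSwinnertonDyer.Theses.PrintX9.HowardContainmentLightFrame := by
  unfold Stmt.stub_cglsHeegnerClassNonvanishing at hNV
  unfold Stmt.stub_cgsHowardDivisibilityPLocalized at hCGS
  exact Summit.BirchSwinnertonDyer.BirchSwinnertonDyer.Theorems.PrintX9OfPrintNonvanishing.howardContainmentLightFrame_of_nonvanishing_of_cgs
    hNV hCGS

/-- The composed line from the stubs (sorries only through `stub_*`). -/
theorem HowardContainmentLightFrame_of_stubs :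
    Summit.BirchSwinnertonDyer.BirchSwinnertonDyer.Theses.PrintX9.HowardContainmentLightFrame :=
  HowardContainmentLightFrame_of stub_cglsHeegnerClassNonvanishing stub_cgsHowardDivisibilityPLocalized

end Summit.BirchSwinnertonDyer.BirchSwinnertonDyer.Cruxes.HowardContainmentLightFrame.TorsionDepthLight
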